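import Summits.Ventures.PercRepro.S2LPTop
import Summits.Ventures.PercRepro.S2LPClasses

/-!
# PercRepro — THE LP INSTANCES TRIMMED TO THEIR NONEMPTY CLASSES (p8 g15, S3; on p2's S2LP machinery)

The exact instances of p2's nullity-split coloop/closure LP (S2LPInstances / S2LPIncidence / S2LPUnsplit) sum over
every core size `s ∈ range (k + 2)` and every rank `r ∈ Icc 2 p`; most of those classes are empty (a nullity-`1`
class needs a core of `≥ 3` points, a nullity-`0` class has an empty core, a `k`-set has rank `≤ k`, and a coloop-free
matroid of rank `p` on `n` points has no `k`-set of rank `r < p` with `n < k + (p − r + 1)`). The four identities below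
rewrite the sums to the nonempty classes, so that a cell consumer carries no zero-class facts. Nothing else is claimed.

* `sum_Icc_rkSets_eq` (the partition rows), `sum_range_nuSets_zero_eq` / `sum_range_mul_nuSets_one_eq` /
  `sum_range_mul'_nuSets_one_eq` (the exact upward and closure identities at nullity `0` and `1`), `sum_range_nuSets_one_eq`,
  `sum_range_mul_nuSets_two_eq`, `sum_range_nuSets_two_eq` (the class partitions at nullity `1` and `2`).
Axioms: standard.
-/

open scoped Matroid

namespace PercRepro

namespace S3LP

open Set Finset S2LP

variable {α : Type} {M : Matroid α} [M.Finite]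

/-- **The partition row trimmed**: in a coloop-free matroid of rank `p` on `n` points the `k`-sets of rank `r ∈ [2, p]`
are counted by the ranks `max 2 (min (k + p + 1 − n) p) ≤ r ≤ min k p` alone. -/
theorem sum_Icc_rkSets_eq {p n : ℕ} (hM : M.eRank = (p : ℕ∞)) (hcol : M.coloops = ∅) (hn : M.E.ncard = n) (k : ℕ) :
    ∑ r ∈ Finset.Icc 2 p, (S1.rkSets M k r).ncard =
      ∑ r ∈ Finset.Icc (max 2 (min (k + p + 1 - n) p)) (min k p), (S1.rkSets M k r).ncard := by
  symm
  apply Finset.sum_subset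
  · intro r hr
    simp only [Finset.mem_Icc] at hr ⊢
    omega
  · intro r hr hnot
    simp only [Finset.mem_Icc] at hr hnot
    rcases Nat.lt_or_ge (min k p) r with hk | hk
    · have hkr : k < r := by omega
      rw [S1.rkSets_eq_empty_of_lt hkr]
      exact ncard_empty _
    · have hlo : r < max 2 (min (k + p + 1 - n) p) := by omega
      have hrp : r < p := by omega
      have hk' : n < k + (p - r + 1) := by omega
      rw [S1.rkSets_eq_empty_of_coloops hM hcol hn hrp hk']
      exact ncard_empty _

/-- **The nullity-`0` classes of the exact upward identity**: only the empty core survives, and it is the class of the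
independent `(k + 1)`-sets. -/
theorem sum_range_nuSets_zero_eq (k : ℕ) :
    ∑ s ∈ Finset.range (k + 2), (k + 1 - s) * (nuSets M (k + 1) 0 s).ncard =
      (k + 1) * (S1.rkSets M (k + 1) (k + 1)).ncard := by
  rw [Finset.sum_range_succ']
  have h0 : ∀ s ∈ Finset.range (k + 1), (k + 1 - (s + 1)) * (nuSets M (k + 1) 0 (s + 1)).ncard = 0 := by
    intro s _
    rw [nuSets_zero_eq_empty _ _ (by omega), ncard_empty, mul_zero]
  rw [Finset.sum_eq_zero h0, zero_add, nuSets_zero_zero_eq]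
  simp

/-- **The nullity-`1` classes of the exact upward / closure identities**: a core of nullity `1` has `≥ 3` points. -/
theorem sum_range_mul_nuSets_one_eq (hpairs : ∀ e ∈ M.E, ∀ f ∈ M.E, e ≠ f → M.eRk {e, f} = 2)
    (hE2 : 2 ≤ M.E.ncard) (k : ℕ) :
    ∑ s ∈ Finset.range (k + 2), s * (nuSets M (k + 1) 1 s).ncard =
      ∑ s ∈ Finset.Icc 3 (k + 1), s * (nuSets M (k + 1) 1 s).ncard := by
  symm
  apply Finset.sum_subset
  · intro s hs
    simp only [Finset.mem_Icc, Finset.mem_range] at hs ⊢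
    omega
  · intro s hs hnot
    simp only [Finset.mem_Icc, Finset.mem_range] at hs hnot
    have hs3 : s < 3 := by omega
    rw [nuSets_eq_empty_of_lt_two hpairs hE2 (by norm_num) (by omega) (by omega), ncard_empty, mul_zero]

/-- **The nullity-`1` class partition trimmed**: `m[k + 1, k] = Σ_{3 ≤ s ≤ k + 1} #nuSets (k + 1) 1 s`. -/
theorem sum_range_nuSets_one_eq (hpairs : ∀ e ∈ M.E, ∀ f ∈ M.E, e ≠ f → M.eRk {e, f} = 2)
    (hE2 : 2 ≤ M.E.ncard) (k : ℕ) :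
    ∑ s ∈ Finset.range (k + 2), (nuSets M (k + 1) 1 s).ncard =
      ∑ s ∈ Finset.Icc 3 (k + 1), (nuSets M (k + 1) 1 s).ncard := by
  symm
  apply Finset.sum_subset
  · intro s hs
    simp only [Finset.mem_Icc, Finset.mem_range] at hs ⊢
    omega
  · intro s hs hnot
    simp only [Finset.mem_Icc, Finset.mem_range] at hs hnot
    have hs3 : s < 3 := by omega
    rw [nuSets_eq_empty_of_lt_two hpairs hE2 (by norm_num) (by omega) (by omega), ncard_empty]

/-- The nullity-`1` classes with the coloop weight `k + 1 − s` trimmed to `s ≥ 3`. -/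
theorem sum_range_mul'_nuSets_one_eq (hpairs : ∀ e ∈ M.E, ∀ f ∈ M.E, e ≠ f → M.eRk {e, f} = 2)
    (hE2 : 2 ≤ M.E.ncard) (k : ℕ) :
    ∑ s ∈ Finset.range (k + 2), (k + 1 - s) * (nuSets M (k + 1) 1 s).ncard =
      ∑ s ∈ Finset.Icc 3 (k + 1), (k + 1 - s) * (nuSets M (k + 1) 1 s).ncard := by
  symm
  apply Finset.sum_subset
  · intro s hs
    simp only [Finset.mem_Icc, Finset.mem_range] at hs ⊢
    omega
  · intro s hs hnot
    simp only [Finset.mem_Icc, Finset.mem_range] at hs hnot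
    have hs3 : s < 3 := by omega
    rw [nuSets_eq_empty_of_lt_two hpairs hE2 (by norm_num) (by omega) (by omega), ncard_empty, mul_zero]

/-- **The nullity-`2` classes trimmed**: a core of nullity `2` has `≥ 5` points when lines have `≤ 3` points. -/
theorem sum_range_mul_nuSets_two_eq (hpairs : ∀ e ∈ M.E, ∀ f ∈ M.E, e ≠ f → M.eRk {e, f} = 2)
    (hlines : ∀ L ⊆ M.E, M.eRk L = 2 → L.ncard ≤ 3) (hE2 : 2 ≤ M.E.ncard) (k : ℕ) (hk : 1 ≤ k) :
    ∑ s ∈ Finset.range (k + 2), s * (nuSets M (k + 1) 2 s).ncard =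
      ∑ s ∈ Finset.Icc 5 (k + 1), s * (nuSets M (k + 1) 2 s).ncard := by
  symm
  apply Finset.sum_subset
  · intro s hs
    simp only [Finset.mem_Icc, Finset.mem_range] at hs ⊢
    omega
  · intro s hs hnot
    simp only [Finset.mem_Icc, Finset.mem_range] at hs hnot
    have hs5 : s < 5 := by omega
    rw [nuSets_eq_empty_of_lt_three_of_lines hpairs hlines hE2 (by norm_num) (by omega) (by omega), ncard_empty, mul_zero]

/-- The nullity-`2` class partition trimmed to `s ≥ 5`. -/
theorem sum_range_nuSets_two_eq (hpairs : ∀ e ∈ M.E, ∀ f ∈ M.E, e ≠ f → M.eRk {e, f} = 2)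
    (hlines : ∀ L ⊆ M.E, M.eRk L = 2 → L.ncard ≤ 3) (hE2 : 2 ≤ M.E.ncard) (k : ℕ) (hk : 1 ≤ k) :
    ∑ s ∈ Finset.range (k + 2), (nuSets M (k + 1) 2 s).ncard =
      ∑ s ∈ Finset.Icc 5 (k + 1), (nuSets M (k + 1) 2 s).ncard := by
  symm
  apply Finset.sum_subset
  · intro s hs
    simp only [Finset.mem_Icc, Finset.mem_range] at hs ⊢
    omega
  · intro s hs hnot
    simp only [Finset.mem_Icc, Finset.mem_range] at hs hnot
    have hs5 : s < 5 := by omega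
    rw [nuSets_eq_empty_of_lt_three_of_lines hpairs hlines hE2 (by norm_num) (by omega) (by omega), ncard_empty]

end S3LP

end PercRepro
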